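import Summits.QuantumFields.BalabanUV.Beta.D1BFx.StencilRealisation
import Summits.QuantumFields.BalabanUV.Beta.D1BFx.PackedKernelSplit

/-!
# `BalabanUV.Beta.D1BFx.BiBubbleTable` — road «BF-x» for binder row D1, «A3.c ∕ L-X TAILS» PART II (F2): the TWO-LEG bubble
# `biBubble A (realK z z V) B (realK z' z' W)` of two realised located-pair lists over ARBITRARY (non-translation-invariant, fibre-indexed) legs IS
# the finite combinatorial table `bub₂ A B z z' V W`; vertex moves transfer to END moves of the legs

HONEST DEPENDENCY (page 1, mandatory): continuum YM on T⁴ ⇐ BetaPertH ∧ nine spine estimates (0/9 proved); BetaPertH ⇐ (D1) ∧ (D4) ∧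
CAP+tail; G-an2-4 gates asym, D1 and NE2/3/4.  HONEST FRAMING (cell contract, verbatim): «discharging `BetaPertH` makes Bałaban's UV
stability UNCONDITIONAL — a real constructive-QFT result; it is NOT the continuum limit and NOT the Clay problem.»  THIS MODULE DISCHARGES
NOTHING of the wall: DATA definitions with bodies ([our objects] `term₂`∕`bubRow₂`∕`bub₂`, the fibred end shifts `shRk`∕`shLk`) and [folklore] finite-sum
bookkeeping over `FiniteStencilCalculus` (`comp_eq_sum_of_rowSupp`, `tr_eq_sum_of_diagSupp`, `elemK`), `StencilRealisation` (`realK`, supports,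
`comp_add_*`, `tr_add_of_diagSupp`, `comp_smul_*`, `tr_smul`; the pattern of its `bubble_realK_realK`), `PackedKernelSplit.biBubble` and an3's
`GradedBubbles` list operations.  No `Prop` minted, nothing cited, 0 sorry.  0 wall binders; NOT an A3.c row, NOT (K), NOT D1, NOT `BetaPertH`, NOT
continuum, NOT Clay.

ABSOLUTE RULE (cell charter, verbatim): «No internally-minted statement may enter as a cited fact. Every hypothesis is either kernel-proved in
this package or a verbatim quotation of a PUBLISHED theorem with page reference. The manuscript(s) under audit are NOT citable for their own
disputed steps — they are the thing under adjudication; programme-internal (2001/route/tribunal) claims are never citable.»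

WHY (owner d1-p2-g9 K-LOCAL-ROWS v0.1 «A3.c = the per-word EXPANSION of `biBubbleTable (legPiece r) (legPiece r′) SbT SbT μ ν (b+w) b` into
vertex-differentiated leg monomials»; RULING ρ-g9-32 «PART II instantiates (D) with the FLAT window grades of `legPiece 1∕2`»).  The 8 L-BUB words have
legs `diagPart Ga − frozenLeg gfrz`, `offPart Ga` — neither translation invariant nor fibre diagonal — so part (A)'s one-variable unfolding does not
apply.  In `tr(A·V·B·W)` with `V` realised at `z` and `W` at `z'`, a located pair `(x_p, y_p, m_p) ∈ V` and `(x_q, y_q, m_q) ∈ W` contribute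
`Σ_{a f f₁ f₂} m_p f₁ f · m_q f₂ a · A (z'+y_q) (z+x_p) a f₁ · B (z+y_p) (z'+x_q) f f₂`: a ROW move of `V` moves `A`'s SECOND argument, a COLUMN
move of `V` moves `B`'s FIRST argument, a ROW move of `W` moves `B`'s SECOND argument, a COLUMN move of `W` moves `A`'s FIRST argument.  With
`z = b + w`, `z' = b` (the road's `baseKer … b w`) the `w`-dependence sits in `A`'s second and `B`'s first argument; the other two ends are STATIC.
* [our objects] `term₂`, `bubRow₂`, `bub₂`, `shRk`, `shLk`; [folklore] `biBubble_eq_sum`, `biBubble_elemK_elemK`, `biBubble_add_left∕right_of_supp`,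
  `biBubble_smul_left∕right`, `biBubble_elemK_realK`, **`biBubble_realK_realK`** (`= bub₂`), `bub₂_append_*`, `bub₂_map_*`, `term₂_rowSh∕colSh_left∕right`,
  **`bub₂_rowSh∕colSh∕rowDiff∕colDiff_left∕right`**, `bub₂_smul_*`, `bub₂_sub_legA∕legB`.
Unit `b2b-balaban-beta-d1-formalise-leaf-03` (gen 12), D1 formalisation swarm; `LEAVES-BFx.md` row «A3.c ∕ L-X TAILS» PART II (F2).
-/

noncomputable section

namespace Summit.QuantumFields.BalabanUV.Beta.D1BFx.BiBubbleTable

open Finset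
open scoped BigOperators
open Literature.MathematicalPhysics.QuantumFieldTheory.Balaban1983to89.Beta
open ExpKernelCalculus (Site MKer comp tr)
open DyadicShell (Pt)
open GradedBubbles (LP Stn rowSh colSh smulS rowDiff colDiff Graded IsStep)
open Summit.QuantumFields.BalabanUV.Beta.D1BFx.FiniteStencilCalculus (comp_eq_sum_of_rowSupp comp_eq_zero_of_colSupp_right comp_eq_sum_of_colSupp
  tr_eq_sum_of_diagSupp elemK elemK_self elemK_rowSupp elemK_colSupp)
open Summit.QuantumFields.BalabanUV.Beta.D1BFx.StencilRealisation (realK realK_nil realK_cons realK_rowSupp realK_colSupp realK_rowSupp_of_subset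
  realK_colSupp_of_subset elemK_rowSupp_of_mem elemK_colSupp_of_mem comp_add_right_of_rowSupp comp_add_left_of_colSupp comp_add_right_of_colSupp_left
  tr_add_of_diagSupp)
open Summit.QuantumFields.BalabanUV.Beta.D1BFx.PackedKernelSplit (biBubble)

/-! ## §1 The combinatorial two-leg table and its identification with `biBubble` over realised lists -/

section Table

variable {I : Type*} [Fintype I]

/-- [our object] ONE PAIR AGAINST ONE PAIR through the legs `A` (second vertex's column → first vertex's row) and `B` (first vertex's column → second
vertex's row): `term₂ A B z z' p q = Σ_{a f f₁ f₂} m_p f₁ f · m_q f₂ a · A (z'+y_q) (z+x_p) a f₁ · B (z+y_p) (z'+x_q) f f₂`. -/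
def term₂ (A B : MKer 4 I) (z z' : Pt) (p q : LP I) : ℝ :=
  ∑ a, ∑ f, ∑ f₁, ∑ f₂, p.m f₁ f * q.m f₂ a * A (z' + q.y) (z + p.x) a f₁ * B (z + p.y) (z' + q.x) f f₂

/-- [our object] One pair of the first list against the second list. -/
def bubRow₂ (A B : MKer 4 I) (z z' : Pt) (p : LP I) : Stn I → ℝ
  | [] => 0
  | q :: W => term₂ A B z z' p q + bubRow₂ A B z z' p W

/-- [our object] **THE TWO-LEG TABLE** of two located-pair lists (first realised at `z`, second at `z'`). -/
def bub₂ (A B : MKer 4 I) (z z' : Pt) : Stn I → Stn I → ℝ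
  | [], _ => 0
  | p :: V, W => bubRow₂ A B z z' p W + bub₂ A B z z' V W

/-- [folklore] **`biBubble` OF TWO FINITELY SUPPORTED STENCILS IS A FINITE SUM** (any legs; `FiniteStencilCalculus.bubble_eq_sum` with two legs). -/
theorem biBubble_eq_sum (A V B W : MKer 4 I) {S₁ T₁ S₂ T₂ : Finset Pt}
    (hS₁ : ∀ y z f b, y ∉ S₁ → V y z f b = 0) (hT₁ : ∀ y z f b, z ∉ T₁ → V y z f b = 0)
    (hS₂ : ∀ y z f b, y ∉ S₂ → W y z f b = 0) (hT₂ : ∀ y z f b, z ∉ T₂ → W y z f b = 0) :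
    biBubble A V B W = ∑ x ∈ T₂, ∑ a, ∑ y ∈ T₁, ∑ f,
      (∑ y₁ ∈ S₁, ∑ f₁, A x y₁ a f₁ * V y₁ y f₁ f) * (∑ y₂ ∈ S₂, ∑ f₂, B y y₂ f f₂ * W y₂ x f₂ a) := by
  unfold PackedKernelSplit.biBubble
  have hcolW : ∀ x y a f, y ∉ T₂ → comp B W x y a f = 0 := fun x y a f hy => comp_eq_zero_of_colSupp_right B W hT₂ x y hy a f
  have hcolV : ∀ x y a f, y ∉ T₁ → comp A V x y a f = 0 := fun x y a f hy => comp_eq_zero_of_colSupp_right A V hT₁ x y hy a f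
  have hdiag : ∀ x a, x ∉ T₂ → comp (comp A V) (comp B W) x x a a = 0 := fun x a hx =>
    comp_eq_zero_of_colSupp_right (comp A V) (comp B W) hcolW x x hx a a
  rw [tr_eq_sum_of_diagSupp _ hdiag]
  refine sum_congr rfl fun x _ => sum_congr rfl fun a _ => ?_
  rw [comp_eq_sum_of_colSupp (comp A V) (comp B W) hcolV x x a a]
  refine sum_congr rfl fun y _ => sum_congr rfl fun f _ => ?_
  rw [comp_eq_sum_of_rowSupp A V hS₁ x y a f, comp_eq_sum_of_rowSupp B W hS₂ y x f a]

/-- [folklore] **TWO ELEMENTARY INSERTIONS, TWO LEGS**: `biBubble A (elemK p q m) B (elemK p′ q′ m′) = Σ_a Σ_f (Σ_{f₁} A q′ p a f₁·m f₁ f)·(Σ_{f₂} B q p′ f f₂·m′ f₂ a)`. -/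
theorem biBubble_elemK_elemK (A B : MKer 4 I) (p q p' q' : Pt) (m m' : I → I → ℝ) :
    biBubble A (elemK p q m) B (elemK p' q' m') = ∑ a, ∑ f, (∑ f₁, A q' p a f₁ * m f₁ f) * (∑ f₂, B q p' f f₂ * m' f₂ a) := by
  rw [biBubble_eq_sum A (elemK p q m) B (elemK p' q' m') (elemK_rowSupp p q m) (elemK_colSupp p q m) (elemK_rowSupp p' q' m')
      (elemK_colSupp p' q' m'), sum_singleton]
  refine sum_congr rfl fun a _ => ?_
  rw [sum_singleton]
  refine sum_congr rfl fun f _ => ?_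
  rw [sum_singleton, sum_singleton]
  simp only [elemK_self]

/-- [folklore] **ADDITIVITY IN THE FIRST STENCIL** (finite supports, any legs). -/
theorem biBubble_add_left_of_supp (A V V' B W : MKer 4 I) {S₁ T₁ T₂ : Finset Pt}
    (hVr : ∀ y z f b, y ∉ S₁ → V y z f b = 0) (hVc : ∀ y z f b, z ∉ T₁ → V y z f b = 0)
    (hV'r : ∀ y z f b, y ∉ S₁ → V' y z f b = 0) (hV'c : ∀ y z f b, z ∉ T₁ → V' y z f b = 0)
    (hWc : ∀ y z f b, z ∉ T₂ → W y z f b = 0) :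
    biBubble A (V + V') B W = biBubble A V B W + biBubble A V' B W := by
  unfold PackedKernelSplit.biBubble
  have hcV : ∀ x y a f, y ∉ T₁ → comp A V x y a f = 0 := fun x y a f hy => comp_eq_zero_of_colSupp_right A V hVc x y hy a f
  have hcV' : ∀ x y a f, y ∉ T₁ → comp A V' x y a f = 0 := fun x y a f hy => comp_eq_zero_of_colSupp_right A V' hV'c x y hy a f
  have hcW : ∀ x y a f, y ∉ T₂ → comp B W x y a f = 0 := fun x y a f hy => comp_eq_zero_of_colSupp_right B W hWc x y hy a f
  have hd : ∀ K : MKer 4 I, ∀ x a, x ∉ T₂ → comp K (comp B W) x x a a = 0 := fun K x a hx =>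
    comp_eq_zero_of_colSupp_right K (comp B W) hcW x x hx a a
  rw [comp_add_right_of_rowSupp A V V' hVr hV'r, comp_add_left_of_colSupp _ _ _ hcV hcV', tr_add_of_diagSupp _ _ (hd (comp A V)) (hd (comp A V'))]

/-- [folklore] **ADDITIVITY IN THE SECOND STENCIL** (finite supports, any legs). -/
theorem biBubble_add_right_of_supp (A V B W W' : MKer 4 I) {T₁ S₂ T₂ : Finset Pt}
    (hVc : ∀ y z f b, z ∉ T₁ → V y z f b = 0)
    (hWr : ∀ y z f b, y ∉ S₂ → W y z f b = 0) (hWc : ∀ y z f b, z ∉ T₂ → W y z f b = 0)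
    (hW'r : ∀ y z f b, y ∉ S₂ → W' y z f b = 0) (hW'c : ∀ y z f b, z ∉ T₂ → W' y z f b = 0) :
    biBubble A V B (W + W') = biBubble A V B W + biBubble A V B W' := by
  unfold PackedKernelSplit.biBubble
  have hcV : ∀ x y a f, y ∉ T₁ → comp A V x y a f = 0 := fun x y a f hy => comp_eq_zero_of_colSupp_right A V hVc x y hy a f
  have hcW : ∀ x y a f, y ∉ T₂ → comp B W x y a f = 0 := fun x y a f hy => comp_eq_zero_of_colSupp_right B W hWc x y hy a f
  have hcW' : ∀ x y a f, y ∉ T₂ → comp B W' x y a f = 0 := fun x y a f hy => comp_eq_zero_of_colSupp_right B W' hW'c x y hy a f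
  rw [comp_add_right_of_rowSupp B W W' hWr hW'r, comp_add_right_of_colSupp_left _ _ _ hcV,
    tr_add_of_diagSupp _ _ (fun x a hx => comp_eq_zero_of_colSupp_right _ _ hcW x x hx a a)
      (fun x a hx => comp_eq_zero_of_colSupp_right _ _ hcW' x x hx a a)]

/-- [folklore] Homogeneity in the first stencil (no hypothesis). -/
theorem biBubble_smul_left (A V B W : MKer 4 I) (c : ℝ) : biBubble A (c • V) B W = c * biBubble A V B W := by
  unfold PackedKernelSplit.biBubble
  rw [StencilRealisation.comp_smul_right, StencilRealisation.comp_smul_left, StencilRealisation.tr_smul]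

/-- [folklore] Homogeneity in the second stencil (no hypothesis). -/
theorem biBubble_smul_right (A V B W : MKer 4 I) (c : ℝ) : biBubble A V B (c • W) = c * biBubble A V B W := by
  unfold PackedKernelSplit.biBubble
  rw [StencilRealisation.comp_smul_right B W, StencilRealisation.comp_smul_right, StencilRealisation.tr_smul]

/-- [folklore] ONE PAIR (first vertex at `z`) AGAINST A REALISED LIST (second vertex at `z'`) IS `bubRow₂`. -/
theorem biBubble_elemK_realK (A B : MKer 4 I) (z z' : Pt) (p : LP I) (W : Stn I) :
    biBubble A (elemK (z + p.x) (z + p.y) (fun a b => p.m a b)) B (realK z' z' W) = bubRow₂ A B z z' p W := by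
  induction W with
  | nil =>
    have h0 := biBubble_smul_right A (elemK (z + p.x) (z + p.y) (fun a b => p.m a b)) B (0 : MKer 4 I) 0
    rw [zero_smul] at h0
    rw [realK_nil, h0, zero_mul]
    rfl
  | cons q W ih =>
    have hWr := realK_rowSupp_of_subset (I := I) z' z' W (subset_insert (z' + q.x) ((W.map fun r => z' + r.x).toFinset))
    have hWc := realK_colSupp_of_subset (I := I) z' z' W (subset_insert (z' + q.y) ((W.map fun r => z' + r.y).toFinset))
    rw [realK_cons, biBubble_add_right_of_supp A _ B _ _ (elemK_colSupp (z + p.x) (z + p.y) _)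
        (elemK_rowSupp_of_mem (z' + q.y) _ (mem_insert_self _ _)) (elemK_colSupp_of_mem (z' + q.x) _ (mem_insert_self _ _)) hWr hWc,
      ih, biBubble_elemK_elemK]
    show _ = term₂ A B z z' p q + bubRow₂ A B z z' p W
    congr 1
    simp only [term₂]
    refine sum_congr rfl fun a _ => sum_congr rfl fun f _ => ?_
    rw [sum_mul]
    refine sum_congr rfl fun f₁ _ => ?_
    rw [mul_sum]
    refine sum_congr rfl fun f₂ _ => ?_
    ring

/-- [folklore] **THE TWO-LEG BRIDGE**: `biBubble A (realK z z V) B (realK z' z' W) = bub₂ A B z z' V W` — any legs, no decay, no summability hypothesis. -/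
theorem biBubble_realK_realK (A B : MKer 4 I) (z z' : Pt) (V W : Stn I) :
    biBubble A (realK z z V) B (realK z' z' W) = bub₂ A B z z' V W := by
  induction V with
  | nil =>
    have h0 := biBubble_smul_left A (0 : MKer 4 I) B (realK z' z' W) 0
    rw [zero_smul] at h0
    rw [realK_nil, h0, zero_mul]
    rfl
  | cons p V ih =>
    have hVr := realK_rowSupp_of_subset (I := I) z z V (subset_insert (z + p.x) ((V.map fun r => z + r.x).toFinset))
    have hVc := realK_colSupp_of_subset (I := I) z z V (subset_insert (z + p.y) ((V.map fun r => z + r.y).toFinset))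
    rw [realK_cons, biBubble_add_left_of_supp A _ _ B _ (elemK_rowSupp_of_mem (z + p.y) _ (mem_insert_self _ _))
        (elemK_colSupp_of_mem (z + p.x) _ (mem_insert_self _ _)) hVr hVc (realK_colSupp z' z' W),
      ih, biBubble_elemK_realK]
    rfl

/-! ### Transfer identities on the table (pure algebra) -/

variable (A B : MKer 4 I) (z z' : Pt)

/-- [our object] A leg with its SECOND argument shifted (all fibre entries). -/
def shRk (e : Pt) (A : MKer 4 I) : MKer 4 I := fun x y a b => A x (y + e) a b

/-- [our object] A leg with its FIRST argument shifted (all fibre entries). -/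
def shLk (e : Pt) (A : MKer 4 I) : MKer 4 I := fun x y a b => A (x + e) y a b

/-- [folklore] `bubRow₂` is additive in the list. -/
theorem bubRow₂_append (p : LP I) (W W' : Stn I) : bubRow₂ A B z z' p (W ++ W') = bubRow₂ A B z z' p W + bubRow₂ A B z z' p W' := by
  induction W with
  | nil => simp [bubRow₂]
  | cons q W ih => simp [bubRow₂, ih, add_assoc]

/-- [folklore] `bub₂` is additive in the first list. -/
theorem bub₂_append_left (V V' W : Stn I) : bub₂ A B z z' (V ++ V') W = bub₂ A B z z' V W + bub₂ A B z z' V' W := by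
  induction V with
  | nil => simp [bub₂]
  | cons p V ih => simp [bub₂, ih, add_assoc]

/-- [folklore] `bub₂` is additive in the second list. -/
theorem bub₂_append_right (V W W' : Stn I) : bub₂ A B z z' V (W ++ W') = bub₂ A B z z' V W + bub₂ A B z z' V W' := by
  induction V with
  | nil => simp [bub₂]
  | cons p V ih => simp only [bub₂, ih, bubRow₂_append]; ring

/-- [folklore] A generic `map` lemma for `bubRow₂`: if `term₂` transforms pairwise, so does the row. -/
theorem bubRow₂_map {A B A' B' : MKer 4 I} {z z' : Pt} (g : LP I → LP I) {p p' : LP I} (c : ℝ)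
    (h : ∀ q, term₂ A B z z' p' (g q) = c * term₂ A' B' z z' p q) (W : Stn I) :
    bubRow₂ A B z z' p' (W.map g) = c * bubRow₂ A' B' z z' p W := by
  induction W with
  | nil => simp [bubRow₂]
  | cons q W ih => simp only [List.map_cons, bubRow₂, ih, h q]; ring

/-- [folklore] A generic `map` lemma for `bub₂` in the first list. -/
theorem bub₂_map_left {A B A' B' : MKer 4 I} {z z' : Pt} (g : LP I → LP I) (c : ℝ)
    (h : ∀ p q, term₂ A B z z' (g p) q = c * term₂ A' B' z z' p q) (V W : Stn I) :
    bub₂ A B z z' (V.map g) W = c * bub₂ A' B' z z' V W := by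
  induction V with
  | nil => simp [bub₂]
  | cons p V ih =>
      simp only [List.map_cons, bub₂, ih]
      have hrow : ∀ W : Stn I, bubRow₂ A B z z' (g p) W = c * bubRow₂ A' B' z z' p W := by
        intro W
        induction W with
        | nil => simp [bubRow₂]
        | cons q W ihW => simp only [bubRow₂, ihW, h p q]; ring
      rw [hrow]; ring

/-- [folklore] A generic `map` lemma for `bub₂` in the second list. -/
theorem bub₂_map_right {A B A' B' : MKer 4 I} {z z' : Pt} (g : LP I → LP I) (c : ℝ)
    (h : ∀ p q, term₂ A B z z' p (g q) = c * term₂ A' B' z z' p q) (V W : Stn I) :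
    bub₂ A B z z' V (W.map g) = c * bub₂ A' B' z z' V W := by
  induction V with
  | nil => simp [bub₂]
  | cons p V ih => simp only [bub₂, ih, bubRow₂_map g c (h p) W]; ring

/-- [folklore] One pair: row shift of the first vertex. -/
theorem term₂_rowSh_left (e : Pt) (p q : LP I) : term₂ A B z z' ⟨p.x + e, p.y, p.m⟩ q = term₂ (shRk e A) B z z' p q := by
  simp only [term₂, shRk, add_assoc]

/-- [folklore] One pair: column shift of the first vertex. -/
theorem term₂_colSh_left (e : Pt) (p q : LP I) : term₂ A B z z' ⟨p.x, p.y + e, p.m⟩ q = term₂ A (shLk e B) z z' p q := by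
  simp only [term₂, shLk, add_assoc]

/-- [folklore] One pair: row shift of the second vertex. -/
theorem term₂_rowSh_right (e : Pt) (p q : LP I) : term₂ A B z z' p ⟨q.x + e, q.y, q.m⟩ = term₂ A (shRk e B) z z' p q := by
  simp only [term₂, shRk, add_assoc]

/-- [folklore] One pair: column shift of the second vertex. -/
theorem term₂_colSh_right (e : Pt) (p q : LP I) : term₂ A B z z' p ⟨q.x, q.y + e, q.m⟩ = term₂ (shLk e A) B z z' p q := by
  simp only [term₂, shLk, add_assoc]

/-- [folklore] **ROW SHIFT OF THE FIRST VERTEX = SHIFT OF `A`'s SECOND ARGUMENT.** -/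
theorem bub₂_rowSh_left (e : Pt) (V W : Stn I) : bub₂ A B z z' (rowSh e V) W = bub₂ (shRk e A) B z z' V W := by
  have h := bub₂_map_left (A := A) (B := B) (A' := shRk e A) (B' := B) (z := z) (z' := z') (fun p : LP I => ⟨p.x + e, p.y, p.m⟩) 1
    (fun p q => by rw [one_mul]; exact term₂_rowSh_left A B z z' e p q) V W
  rw [one_mul] at h
  exact h

/-- [folklore] **COLUMN SHIFT OF THE FIRST VERTEX = SHIFT OF `B`'s FIRST ARGUMENT.** -/
theorem bub₂_colSh_left (e : Pt) (V W : Stn I) : bub₂ A B z z' (colSh e V) W = bub₂ A (shLk e B) z z' V W := by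
  have h := bub₂_map_left (A := A) (B := B) (A' := A) (B' := shLk e B) (z := z) (z' := z') (fun p : LP I => ⟨p.x, p.y + e, p.m⟩) 1
    (fun p q => by rw [one_mul]; exact term₂_colSh_left A B z z' e p q) V W
  rw [one_mul] at h
  exact h

/-- [folklore] **ROW SHIFT OF THE SECOND VERTEX = SHIFT OF `B`'s SECOND ARGUMENT.** -/
theorem bub₂_rowSh_right (e : Pt) (V W : Stn I) : bub₂ A B z z' V (rowSh e W) = bub₂ A (shRk e B) z z' V W := by
  have h := bub₂_map_right (A := A) (B := B) (A' := A) (B' := shRk e B) (z := z) (z' := z') (fun q : LP I => ⟨q.x + e, q.y, q.m⟩) 1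
    (fun p q => by rw [one_mul]; exact term₂_rowSh_right A B z z' e p q) V W
  rw [one_mul] at h
  exact h

/-- [folklore] **COLUMN SHIFT OF THE SECOND VERTEX = SHIFT OF `A`'s FIRST ARGUMENT.** -/
theorem bub₂_colSh_right (e : Pt) (V W : Stn I) : bub₂ A B z z' V (colSh e W) = bub₂ (shLk e A) B z z' V W := by
  have h := bub₂_map_right (A := A) (B := B) (A' := shLk e A) (B' := B) (z := z) (z' := z') (fun q : LP I => ⟨q.x, q.y + e, q.m⟩) 1
    (fun p q => by rw [one_mul]; exact term₂_colSh_right A B z z' e p q) V W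
  rw [one_mul] at h
  exact h

/-- [folklore] Scalars in the first list. -/
theorem bub₂_smul_left (c : ℝ) (V W : Stn I) : bub₂ A B z z' (smulS c V) W = c * bub₂ A B z z' V W :=
  bub₂_map_left (A := A) (B := B) (A' := A) (B' := B) (z := z) (z' := z') (fun p : LP I => ⟨p.x, p.y, c • p.m⟩) c
    (fun p q => by
      simp only [term₂, Matrix.smul_apply, smul_eq_mul, mul_sum]
      exact sum_congr rfl fun a _ => sum_congr rfl fun f _ => sum_congr rfl fun f₁ _ => sum_congr rfl fun f₂ _ => by ring) V W

/-- [folklore] Scalars in the second list. -/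
theorem bub₂_smul_right (c : ℝ) (V W : Stn I) : bub₂ A B z z' V (smulS c W) = c * bub₂ A B z z' V W :=
  bub₂_map_right (A := A) (B := B) (A' := A) (B' := B) (z := z) (z' := z') (fun q : LP I => ⟨q.x, q.y, c • q.m⟩) c
    (fun p q => by
      simp only [term₂, Matrix.smul_apply, smul_eq_mul, mul_sum]
      exact sum_congr rfl fun a _ => sum_congr rfl fun f _ => sum_congr rfl fun f₁ _ => sum_congr rfl fun f₂ _ => by ring) V W

/-- [folklore] `bub₂` is additive in the leg `A`. -/
theorem bub₂_sub_legA (A A' B : MKer 4 I) (V W : Stn I) : bub₂ (A - A') B z z' V W = bub₂ A B z z' V W - bub₂ A' B z z' V W := by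
  induction V with
  | nil => simp [bub₂]
  | cons p V ih =>
      have hrow : ∀ W : Stn I, bubRow₂ (A - A') B z z' p W = bubRow₂ A B z z' p W - bubRow₂ A' B z z' p W := by
        intro W
        induction W with
        | nil => simp [bubRow₂]
        | cons q W ihW =>
            simp only [bubRow₂, ihW]
            have : term₂ (A - A') B z z' p q = term₂ A B z z' p q - term₂ A' B z z' p q := by
              simp only [term₂, Pi.sub_apply, ← sum_sub_distrib]
              exact sum_congr rfl fun a _ => sum_congr rfl fun f _ => sum_congr rfl fun f₁ _ => sum_congr rfl fun f₂ _ => by ring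
            rw [this]; ring
      simp only [bub₂, hrow, ih]; ring

/-- [folklore] `bub₂` is additive in the leg `B`. -/
theorem bub₂_sub_legB (A B B' : MKer 4 I) (V W : Stn I) : bub₂ A (B - B') z z' V W = bub₂ A B z z' V W - bub₂ A B' z z' V W := by
  induction V with
  | nil => simp [bub₂]
  | cons p V ih =>
      have hrow : ∀ W : Stn I, bubRow₂ A (B - B') z z' p W = bubRow₂ A B z z' p W - bubRow₂ A B' z z' p W := by
        intro W
        induction W with
        | nil => simp [bubRow₂]
        | cons q W ihW =>
            simp only [bubRow₂, ihW]
            have : term₂ A (B - B') z z' p q = term₂ A B z z' p q - term₂ A B' z z' p q := by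
              simp only [term₂, Pi.sub_apply, ← sum_sub_distrib]
              exact sum_congr rfl fun a _ => sum_congr rfl fun f _ => sum_congr rfl fun f₁ _ => sum_congr rfl fun f₂ _ => by ring
            rw [this]; ring
      simp only [bub₂, hrow, ih]; ring

/-- [folklore] **ROW DIFFERENCE OF THE FIRST VERTEX = DIFFERENCE OF `A`'s SECOND ARGUMENT.** -/
theorem bub₂_rowDiff_left (e : Pt) (V W : Stn I) : bub₂ A B z z' (rowDiff e V) W = bub₂ (shRk e A - A) B z z' V W := by
  rw [rowDiff, bub₂_append_left, bub₂_rowSh_left, bub₂_smul_left, bub₂_sub_legA]; ring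

/-- [folklore] **COLUMN DIFFERENCE OF THE FIRST VERTEX = DIFFERENCE OF `B`'s FIRST ARGUMENT.** -/
theorem bub₂_colDiff_left (e : Pt) (V W : Stn I) : bub₂ A B z z' (colDiff e V) W = bub₂ A (shLk e B - B) z z' V W := by
  rw [colDiff, bub₂_append_left, bub₂_colSh_left, bub₂_smul_left, bub₂_sub_legB]; ring

/-- [folklore] **ROW DIFFERENCE OF THE SECOND VERTEX = DIFFERENCE OF `B`'s SECOND ARGUMENT.** -/
theorem bub₂_rowDiff_right (e : Pt) (V W : Stn I) : bub₂ A B z z' V (rowDiff e W) = bub₂ A (shRk e B - B) z z' V W := by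
  rw [rowDiff, bub₂_append_right, bub₂_rowSh_right, bub₂_smul_right, bub₂_sub_legB]; ring

/-- [folklore] **COLUMN DIFFERENCE OF THE SECOND VERTEX = DIFFERENCE OF `A`'s FIRST ARGUMENT.** -/
theorem bub₂_colDiff_right (e : Pt) (V W : Stn I) : bub₂ A B z z' V (colDiff e W) = bub₂ (shLk e A - A) B z z' V W := by
  rw [colDiff, bub₂_append_right, bub₂_colSh_right, bub₂_smul_right, bub₂_sub_legA]; ring

end Table

end Summit.QuantumFields.BalabanUV.Beta.D1BFx.BiBubbleTable

end
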